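/-
Copyright (c) 2026. All rights reserved.
Released under Apache 2.0 license as described in the file LICENSE.
Authors: abc-iut cell, wave-2 prover seat abc-iut-L6-t6 (pool D-η item D-η-2, closing file).
-/
import Literature.AlgebraicGeometry.Frobenioids.DivisorialDescriptionsProofs
import Literature.AlgebraicGeometry.Frobenioids.DivisorialDescriptionsProofsII
import HarnessLib

/-!
# Frobenioids I, Theorem 5.1 (ii) — unconditional (proof-only)

Mochizuki, *The geometry of Frobenioids I: the general theory*, Kyushu J. Math. **62** (2008),
Theorem 5.1 (ii), kurims text pp. 96–97 [cite: MochizukiFrdI2008, Thm. 5.1 (ii) p.97]. Combines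
abc-iut-L1-t10's `thm51i_holds : Thm51i F A` (Theorem 5.1 (i), `DivisorialDescriptionsProofs.lean`) with
`thm51ii_of_thm51i : Thm51i F A → Thm51ii F A A'` (`DivisorialDescriptionsProofsII.lean`): the named
statement `Thm51ii F A A'` of abc-iut-L1-t5's `DivisorialDescriptions.lean` holds for every Frobenioid of
isotropic type and all Frobenius-trivial `A, A'` (the hypotheses are inside the named statement). The
"Moreover" (uniqueness) clause is `thm51ii_unique` (abc-iut-L1-t5). No new definitions.
-/

namespace Literature.AlgebraicGeometry.Frobenioids

open CategoryTheory Opposite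

namespace PreFrobenioid

universe w v v' u u'

variable {D : Type u} [Category.{v} D] {Φ : Dᵒᵖ ⥤ CommMonCat.{w}}
  {C : Type u'} [Category.{v'} C] (F : C ⥤ ElemFrobenioid Φ)

/-- **[FrdI] Theorem 5.1 (ii), PROVED**: the existence criterion "there exists a morphism `φ : B → B'`
of Frobenius degree `d` with `Base(φ) = (λ')⁻¹ ∘ θ ∘ λ` and `Div(φ) = z` if and only if
`d · β + z|_{A_D} = (Φ(θ))(β')` in `Pic_Φ(A)`" — the named statement `Thm51ii F A A'`
(`Ψ = Φ^birat = biratSubfunctor F`). [cite: MochizukiFrdI2008, Thm. 5.1 (ii) p.97] -/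
theorem thm51ii_holds (A A' : C) : Thm51ii F A A' :=
  thm51ii_of_thm51i (thm51i_holds F A)

end PreFrobenioid

end Literature.AlgebraicGeometry.Frobenioids
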